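import Literature.IUT.HodgeTheaters.InitialThetaDataQRootProofs
import Literature.NumberTheory.NumberFields.PrimitiveRootRamificationProofs
import Literature.NumberTheory.EllipticCurves.WeilPairingRootsOfUnityHolds
import HarnessLib

/-!
# Initial Θ-data: `μ_l ⊆ K` — the field `K = F(E_F[l])` of [IUTchI] Def. 3.1 (c) contains a primitive `l`-th root of unity,
# hence `(l − 1) ∣ e(w | l)` at every place `w` of `K` over `l` (proof-only)

`Proofs` companion (theorems only; no definition, no named fact, no instance) of
`Literature.IUT.HodgeTheaters.InitialThetaData` (abc-iut-L5-t2: the REAL [IUTchI] Def. 3.1), by the cell `abc-iut`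
(seat abc-iut-s2-p4; closes GAP-LEDGER row G-c312d1g8-1 «wanted `InitialThetaData.exists_isPrimitiveRoot`»).
Mochizuki, *Inter-universal Teichmüller theory I*, Def. 3.1 (c) (kurims May-2020 manuscript p. 62): "`K ⊆ F̄` … the finite
Galois extension of `F` determined by the kernel of [`G_F → GL₂(𝔽_l)`]", i.e. `K = F(E_F[l])`, so the `l`-torsion of `E_F` is
`K`-rational; Silverman, *The Arithmetic of Elliptic Curves*, Cor. III.8.1.1 ("if `E[m] ⊂ E(K)`, then `μ_m ⊂ K^*`", by the Galois
equivariance of the Weil pairing — the tree's `WeierstrassCurve.exists_isPrimitiveRoot_of_card_torsionBy_eq_sq_holds`) and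
Cor. III.6.4 (b) (`#E[m] = m²`, the tree's `WeierstrassCurve.card_torsionBy_eq_sq`); Washington, *Introduction to Cyclotomic
Fields*, Lemma 1.4 / Prop. 2.1 (`l` is totally ramified in `ℚ(ζ_l)`; the tree's
`Literature.NumberTheory.NumberFields.sub_one_dvd_ramificationIdx_of_isPrimitiveRoot`, abc-iut-W-neg-1).
For `D : InitialThetaData F K Fbar E l Pb` this file proves:

* `InitialThetaData.natCard_torsionBy_baseChange_eq_sq` — `#E_F(K)[l] = l²`: the `K`-rational `l`-torsion of `E_F` maps
  bijectively onto the geometric `l`-torsion `E_F[l](F̄)` (injective base change; onto by Def. 3.1 (c),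
  `mem_range_baseChange_of_l_torsion`), which has `l²` elements (Silverman III.6.4 (b) over the algebraically closed `F̄`);
* **`InitialThetaData.exists_isPrimitiveRoot`** — `∃ ζ : K, IsPrimitiveRoot ζ l` (`μ_l ⊆ K`, Silverman III.8.1.1 for the
  elliptic curve `E_F ×_F K` over the perfect field `K`, `l ≥ 5` prime);
* `InitialThetaData.sub_one_dvd_ramificationIdx` — `(l − 1) ∣ e(w | l)` for every finite place `w` of `K` over `l`
  (for `K : Type`, the universe of the tree's ramification lemma); `InitialThetaData.sub_one_le_ramificationIdx` — hence
  `l − 1 ≤ e(w | l)`.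

Consumer (abc-iut C lane, ruling C-R53 «C:PERIMAGE-1061-13-ζ»): the explicit ramification hypothesis `hram` (`m = l − 1` over
the places above `l`) of abc-iut-c312-d1's `Cor22.ThetaVolumeDatumAt.cor312PerImageOf_of_le_logDiff_logCond_ramified`.
Classical facts about the typed Def. 3.1 data; nothing of the series is asserted; no side is taken on [IUTchIII] Cor. 3.12;
typed ≠ proved.

## References
* [Mochizuki2012] S. Mochizuki, IUT I, Def. 3.1 (c) p. 62. [claim: Mochizuki2012, status: disputed]
* [SilvermanAEC2009] J. H. Silverman, *The Arithmetic of Elliptic Curves*, 2nd ed., GTM 106 (2009), Cor. III.6.4 (b),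
  Cor. III.8.1.1 (p. 96).
* [Washington1997] L. C. Washington, *Introduction to Cyclotomic Fields*, 2nd ed. (1997), Lemma 1.4, Prop. 2.1.
-/

noncomputable section

open scoped Classical NumberField
open WeierstrassCurve

universe u v w

namespace Literature.IUT.HodgeTheaters

namespace InitialThetaData

/-! ### `#E_F(K)[l] = l²` and `μ_l ⊆ K` -/

section RootsOfUnity

variable {F : Type u} {K : Type v} {Fbar : Type w} [Field F] [NumberField F] [Field K]
  [NumberField K] [Algebra F K] [Field Fbar] [Algebra F Fbar] [Algebra K Fbar]
  {E : WeierstrassCurve F} [E.IsElliptic] {l : ℕ} {Pb : BadPlacePredicates K}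
  (D : InitialThetaData F K Fbar E l Pb)

include D

/-- **`#E_F(K)[l] = l²`** ([IUTchI] Def. 3.1 (c): `K = F(E_F[l])`): the `l`-torsion subgroup of the `K`-rational points of
`E_F ×_F K` has exactly `l²` elements — base change `E_F(K) → E_F(F̄)` is injective, carries the `K`-rational `l`-torsion
ONTO the geometric `l`-torsion (every `l`-torsion point of `E_F(F̄)` comes from `E_F(K)`, `mem_range_baseChange_of_l_torsion`),
and `#E_F[l](F̄) = l²` (Silverman III.6.4 (b), the tree's `card_torsionBy_eq_sq` over the algebraically closed `F̄`).
[claim: Mochizuki2012, status: disputed] [cite: SilvermanAEC2009, Cor. III.6.4(b)] -/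
theorem natCard_torsionBy_baseChange_eq_sq :
    Nat.card (AddSubgroup.torsionBy (E.baseChange K).toAffine.Point (l : ℤ)) = l ^ 2 := by
  haveI := D.isAlgClosure
  haveI := D.isScalarTower
  haveI : IsAlgClosed Fbar := IsAlgClosure.isAlgClosed F
  haveI : (E.baseChange Fbar).IsElliptic := inferInstanceAs (E.map (algebraMap F Fbar)).IsElliptic
  haveI : CharZero Fbar := charZero_of_injective_algebraMap (algebraMap F Fbar).injective
  -- `E_F(K) → E_F(F̄)`, injective
  set ι : (E.toAffine.baseChange K).Point →+ (E.toAffine.baseChange Fbar).Point :=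
    Affine.Point.baseChange (W' := E.toAffine) K Fbar with hι
  have hιinj : Function.Injective ι := Affine.Point.map_injective _
  -- the `K`-rational `l`-torsion as a set
  set A : Set (E.toAffine.baseChange K).Point := {Q | l • Q = 0} with hA
  have hAeq : (AddSubgroup.torsionBy (E.baseChange K).toAffine.Point (l : ℤ) :
      Set (E.baseChange K).toAffine.Point) = A := by
    ext Q
    change Q ∈ AddSubgroup.torsionBy _ (l : ℤ) ↔ l • Q = 0
    exact AddSubgroup.torsionBy.nsmul_iff
  -- its image is the geometric `l`-torsion (onto by Def. 3.1 (c))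
  have himage : ι '' A =
      (AddSubgroup.torsionBy (GeomPoints Fbar E) (l : ℤ) : Set (GeomPoints Fbar E)) := by
    ext R
    constructor
    · rintro ⟨Q, hQ, rfl⟩
      change ι Q ∈ AddSubgroup.torsionBy _ (l : ℤ)
      rw [AddSubgroup.torsionBy.nsmul_iff, ← map_nsmul, show l • Q = 0 from hQ, map_zero]
    · intro hR
      change R ∈ AddSubgroup.torsionBy _ (l : ℤ) at hR
      rw [AddSubgroup.torsionBy.nsmul_iff] at hR
      have hRz : (l : ℤ) • R = 0 := by rw [natCast_zsmul]; exact hR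
      obtain ⟨Q, hQ⟩ := D.mem_range_baseChange_of_l_torsion R hRz
      refine ⟨Q, ?_, hQ⟩
      change l • Q = 0
      apply hιinj
      rw [map_nsmul, hQ, map_zero, hR]
  -- `#E_F[l](F̄) = l²`
  have hcardB : (AddSubgroup.torsionBy (GeomPoints Fbar E) (l : ℤ) : Set (GeomPoints Fbar E)).ncard = l ^ 2 := by
    rw [← Nat.card_coe_set_eq]
    have hlF : ((l : ℕ) : Fbar) ≠ 0 := by exact_mod_cast D.l_prime.ne_zero
    exact card_torsionBy_eq_sq (E := E.baseChange Fbar) hlF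
  have hcardA : A.ncard = l ^ 2 := by
    rw [← Set.ncard_image_of_injective A hιinj, himage, hcardB]
  change Nat.card ((AddSubgroup.torsionBy (E.baseChange K).toAffine.Point (l : ℤ) :
    Set (E.baseChange K).toAffine.Point)) = l ^ 2
  rw [Nat.card_coe_set_eq, hAeq]
  exact hcardA

/-- **`μ_l ⊆ K`: the field `K` of [IUTchI] Def. 3.1 (c) contains a primitive `l`-th root of unity** (GAP-LEDGER row
G-c312d1g8-1 of the cell abc-iut). `K = F(E_F[l])` makes the `l`-torsion of the elliptic curve `E_F ×_F K` over the perfect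
field `K` fully rational (`natCard_torsionBy_baseChange_eq_sq`: `l²` points), `l ≥ 5` is prime and nonzero in `K`, so the
Galois equivariance of the Weil pairing puts `μ_l` inside `K` — Silverman, *AEC* Cor. III.8.1.1 "if `E[m] ⊂ E(K)`, then
`μ_m ⊂ K^*`", the tree's `WeierstrassCurve.exists_isPrimitiveRoot_of_card_torsionBy_eq_sq_holds`.
[claim: Mochizuki2012, status: disputed] [cite: SilvermanAEC2009, Cor. III.8.1.1] -/
theorem exists_isPrimitiveRoot : ∃ ζ : K, IsPrimitiveRoot ζ l := by
  haveI : (E.baseChange K).IsElliptic := inferInstanceAs (E.map (algebraMap F K)).IsElliptic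
  have h2 : 2 ≤ l := D.l_prime.two_le
  have hlK : (l : K) ≠ 0 := by exact_mod_cast D.l_prime.ne_zero
  exact (E.baseChange K).exists_isPrimitiveRoot_of_card_torsionBy_eq_sq_holds l h2 hlK
    D.natCard_torsionBy_baseChange_eq_sq

end RootsOfUnity

/-! ### `(l − 1) ∣ e(w | l)` at the places of `K` over `l` -/

section Ramification

open NumberField IsDedekindDomain Literature.NumberTheory.NumberFields

variable {F : Type u} {K : Type} {Fbar : Type w} [Field F] [NumberField F] [Field K]
  [NumberField K] [Algebra F K] [Field Fbar] [Algebra F Fbar] [Algebra K Fbar]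
  {E : WeierstrassCurve F} [E.IsElliptic] {l : ℕ} {Pb : BadPlacePredicates K}
  (D : InitialThetaData F K Fbar E l Pb)

include D

/-- **`(l − 1) ∣ e(w | l)` for every finite place `w` of `K` over `l`** ([IUTchI] Def. 3.1 (c) data; `K : Type`):
`ζ_l ∈ K` (`exists_isPrimitiveRoot`, Silverman III.8.1.1) and `l` is totally ramified of index `l − 1` in `ℚ(ζ_l) ⊆ K`
(Washington Lemma 1.4 / Prop. 2.1; ramification indices multiply in `ℤ ⊆ 𝓞_{ℚ(ζ_l)} ⊆ 𝓞_K` — abc-iut-W-neg-1's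
`sub_one_dvd_ramificationIdx_of_isPrimitiveRoot`). [claim: Mochizuki2012, status: disputed]
[cite: Washington1997, Lemma 1.4 and Prop. 2.1] [cite: SilvermanAEC2009, Cor. III.8.1.1] -/
theorem sub_one_dvd_ramificationIdx (w : HeightOneSpectrum (𝓞 K)) (hw : ((l : ℕ) : 𝓞 K) ∈ w.asIdeal) :
    (l - 1) ∣ w.asIdeal.ramificationIdx ℤ := by
  obtain ⟨ζ, hζ⟩ := D.exists_isPrimitiveRoot
  exact sub_one_dvd_ramificationIdx_of_isPrimitiveRoot D.l_prime hζ w hw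

/-- **`l − 1 ≤ e(w | l)` for every finite place `w` of `K` over `l`**: the absolute ramification index of a prime of the
number field `K` is positive (`𝓞_K` is a finite free `ℤ`-module, so `l·𝓞_K ≠ 0` and `w ∣ l·𝓞_K`), and `(l − 1) ∣ e(w | l)`
(`sub_one_dvd_ramificationIdx`). This is the shape `m ≤ e` (`m = l − 1`) of the explicit ramification hypothesis of the
abc-iut C-lane per-image sufficiency `Cor22.ThetaVolumeDatumAt.cor312PerImageOf_of_le_logDiff_logCond_ramified`.
[claim: Mochizuki2012, status: disputed] [cite: Washington1997, Lemma 1.4 and Prop. 2.1] -/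
theorem sub_one_le_ramificationIdx (w : HeightOneSpectrum (𝓞 K)) (hw : ((l : ℕ) : 𝓞 K) ∈ w.asIdeal) :
    l - 1 ≤ w.asIdeal.ramificationIdx ℤ :=
  Nat.le_of_dvd (Ideal.ramificationIdx_pos _ _) (D.sub_one_dvd_ramificationIdx w hw)

end Ramification

/-! ### The relative form over a subfield `F₀ ⊆ K`: `(l − 1) ∣ e(v | p)·e(w | v)`, hence `l − 1 ≤ e(w | v)` when `e(v | l) = 1` -/

section Relative

open NumberField IsDedekindDomain Literature.NumberTheory.NumberFields Literature.IUT.LogVolume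

variable {F : Type u} {K : Type} {Fbar : Type w} [Field F] [NumberField F] [Field K]
  [NumberField K] [Algebra F K] [Field Fbar] [Algebra F Fbar] [Algebra K Fbar]
  {E : WeierstrassCurve F} [E.IsElliptic] {l : ℕ} {Pb : BadPlacePredicates K}
  (D : InitialThetaData F K Fbar E l Pb)
  {F₀ : Type} [Field F₀] [NumberField F₀] [Algebra F₀ K]

include D

/-- **Tower form `(l − 1) ∣ e(v | p_v)·e(w | v)`** for ANY number field `F₀` mapping to `K` (`Algebra F₀ K`; e.g. `F₀ = F_mod`,
`F_tpd`, `F`), a finite place `v` of `F₀` over `l` and a prime `w` of `𝓞_K` over `v` (a member of Mathlib's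
`IsDedekindDomain.primesOverFinset v (𝓞 K)`): the absolute index `e(w | l)` is divisible by `l − 1`
(`sub_one_dvd_ramificationIdx`) and factors as `e(v | l)·e(w | v)` in `ℤ ⊆ 𝓞_{F₀} ⊆ 𝓞_K` (the tree's
`ThetaData.absRamificationIdx_eq_ramIdx_mul`; `e(v | l) = ramIdx F₀ v`, `e(w | v) =` Mathlib's `Ideal.ramificationIdx' v w`).
[claim: Mochizuki2012, status: disputed] [cite: Washington1997, Lemma 1.4 and Prop. 2.1] [cite: NeukirchANT1999, Ch. II Prop. (6.8)] -/
theorem sub_one_dvd_ramIdx_mul_ramificationIdx' (v : HeightOneSpectrum (𝓞 F₀)) (hv : ((l : ℕ) : 𝓞 F₀) ∈ v.asIdeal)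
    {w : Ideal (𝓞 K)} (hw : w ∈ IsDedekindDomain.primesOverFinset v.asIdeal (𝓞 K)) :
    (l - 1) ∣ ramIdx F₀ v * Ideal.ramificationIdx' v.asIdeal w := by
  haveI : v.asIdeal.IsMaximal := v.isMaximal
  have hw' := (IsDedekindDomain.mem_primesOverFinset_iff v.ne_bot (𝓞 K)).mp hw
  haveI : w.IsPrime := hw'.1
  haveI : w.LiesOver v.asIdeal := hw'.2
  have hwbot : w ≠ ⊥ := Ideal.ne_bot_of_liesOver_of_ne_bot v.ne_bot w
  set W : HeightOneSpectrum (𝓞 K) := ⟨w, hw'.1, hwbot⟩ with hW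
  -- `w ∩ 𝓞 F₀ = v`
  have hunder : W.under (𝓞 F₀) = v :=
    HeightOneSpectrum.ext (Ideal.LiesOver.over (P := w) (p := v.asIdeal)).symm
  -- `l ∈ w`
  have hlw : ((l : ℕ) : 𝓞 K) ∈ W.asIdeal := by
    have h := Ideal.mem_comap.mp ((Ideal.LiesOver.over (P := w) (p := v.asIdeal)) ▸ hv :
      ((l : ℕ) : 𝓞 F₀) ∈ w.under (𝓞 F₀))
    rwa [map_natCast] at h
  have habs := D.sub_one_dvd_ramificationIdx W hlw
  rw [ThetaData.absRamificationIdx_eq_ramIdx_mul (F := F₀) W, hunder] at habs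
  exact habs

/-- **`l − 1 ≤ e(w | v)` whenever `e(v | l)` is prime to `l − 1`** (e.g. `l` unramified at `v` in `F₀`): from the tower form and
`e(w | v) > 0`. [claim: Mochizuki2012, status: disputed] [cite: Washington1997, Lemma 1.4 and Prop. 2.1]
[cite: NeukirchANT1999, Ch. II Prop. (6.8)] -/
theorem sub_one_le_ramificationIdx'_of_coprime (v : HeightOneSpectrum (𝓞 F₀)) (hv : ((l : ℕ) : 𝓞 F₀) ∈ v.asIdeal)
    (hcop : (l - 1).Coprime (ramIdx F₀ v))
    {w : Ideal (𝓞 K)} (hw : w ∈ IsDedekindDomain.primesOverFinset v.asIdeal (𝓞 K)) :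
    l - 1 ≤ Ideal.ramificationIdx' v.asIdeal w := by
  haveI : v.asIdeal.IsMaximal := v.isMaximal
  have hw' := (IsDedekindDomain.mem_primesOverFinset_iff v.ne_bot (𝓞 K)).mp hw
  haveI : w.IsPrime := hw'.1
  haveI : w.LiesOver v.asIdeal := hw'.2
  have hwbot : w ≠ ⊥ := Ideal.ne_bot_of_liesOver_of_ne_bot v.ne_bot w
  have hdvd : (l - 1) ∣ Ideal.ramificationIdx' v.asIdeal w :=
    hcop.dvd_of_dvd_mul_left (D.sub_one_dvd_ramIdx_mul_ramificationIdx' v hv hw)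
  -- `e(w | v) > 0`: `e(w | l) = e(v | l)·e(w | v) > 0`
  set W : HeightOneSpectrum (𝓞 K) := ⟨w, hw'.1, hwbot⟩ with hW
  have hunder : W.under (𝓞 F₀) = v :=
    HeightOneSpectrum.ext (Ideal.LiesOver.over (P := w) (p := v.asIdeal)).symm
  have hpos : 0 < W.asIdeal.ramificationIdx ℤ := Ideal.ramificationIdx_pos _ _
  rw [ThetaData.absRamificationIdx_eq_ramIdx_mul (F := F₀) W, hunder] at hpos
  exact Nat.le_of_dvd (Nat.pos_of_ne_zero fun h0 => by rw [h0, mul_zero] at hpos; exact lt_irrefl 0 hpos) hdvd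

/-- **`l − 1 ≤ e(w | v)` over a subfield `F₀` of degree `1`** (`F₀ = ℚ` presented as a number field, e.g. the field `F_tpd`
of a `ℚ`-rational point): `e(v | l) ≤ [F₀ : ℚ] = 1` (Mathlib `Ideal.ramificationIdx_le_finrank`). This is VERBATIM the
explicit ramification hypothesis (`Sₓ` = the places over `l`, `m = l − 1`) of the abc-iut C-lane per-image sufficiency
`Cor22.ThetaVolumeDatumAt.cor312PerImageOf_of_le_logDiff_logCond_ramified` at a `ℚ`-rational datum.
[claim: Mochizuki2012, status: disputed] [cite: Washington1997, Lemma 1.4 and Prop. 2.1] [cite: NeukirchANT1999, Ch. II Prop. (6.8)] -/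
theorem sub_one_le_ramificationIdx'_of_finrank_eq_one (hF₀ : Module.finrank ℚ F₀ = 1)
    (v : HeightOneSpectrum (𝓞 F₀)) (hv : ((l : ℕ) : 𝓞 F₀) ∈ v.asIdeal)
    {w : Ideal (𝓞 K)} (hw : w ∈ IsDedekindDomain.primesOverFinset v.asIdeal (𝓞 K)) :
    l - 1 ≤ Ideal.ramificationIdx' v.asIdeal w := by
  refine D.sub_one_le_ramificationIdx'_of_coprime v hv ?_ hw
  -- `e(v | l) = 1`
  have h1 : ramIdx F₀ v = 1 := by
    haveI : (v.asIdeal.under ℤ).IsMaximal := Ideal.IsMaximal.under ℤ v.asIdeal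
    have h0 : v.asIdeal.under ℤ ≠ ⊥ := mt Ideal.eq_bot_of_comap_eq_bot v.ne_bot
    have hle : v.asIdeal.ramificationIdx ℤ ≤ Module.finrank ℚ F₀ := by
      rw [← Ideal.ramificationIdx'_eq_ramificationIdx (v.asIdeal.under ℤ) v.asIdeal h0]
      exact Ideal.ramificationIdx_le_finrank (𝓞 F₀) ℚ F₀ v.asIdeal (p := v.asIdeal.under ℤ)
    rw [hF₀, ← ramIdx_eq] at hle
    have hne : ramIdx F₀ v ≠ 0 := ramIdx_ne_zero F₀ v
    omega
  rw [h1]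
  exact Nat.coprime_one_right _

end Relative

end InitialThetaData

end Literature.IUT.HodgeTheaters

end
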